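import Mathlib.Analysis.Convex.Topology
import Mathlib.Analysis.InnerProductSpace.Basic
import Mathlib.Analysis.MellinTransform
import Mathlib.Analysis.SpecialFunctions.Integrals.Basic
import Mathlib.NumberTheory.LSeries.Dirichlet
import Mathlib.Analysis.Complex.Convex
import Mathlib.Analysis.Complex.CauchyIntegral
import Mathlib.Analysis.Analytic.Uniqueness
import Literature.NumberTheory.Automorphic.MeyerThetaMellinCoeff
import Literature.Analysis.Complex.Hurwitz
import Literature.NumberTheory.LFunctions.RiemannXiProofs
import Literature.NumberTheory.LFunctions.WeilGroundStateRealZeros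
import Literature.NumberTheory.LFunctions.WeilGroundEnergyProofs
import Literature.NumberTheory.LFunctions.UniformWeilPositivityRH
import Literature.NumberTheory.LFunctions.WeilWindowSuzukiProofs
import Literature.NumberTheory.LFunctions.WeilExplicitFormulaProofs
import Literature.NumberTheory.LFunctions.WeilExplicitProofs
import Literature.NumberTheory.LFunctions.ZetaZerosReflection
import Literature.NumberTheory.LFunctions.ZetaZerosProofs
import Literature.NumberTheory.LFunctions.WeilZeroSum
import Summits.RiemannHypothesis.RiemannHypothesis.Statement
import HarnessLib

/-!
# The endgame of the semilocal (Weil ground state) programme, assembled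

Connes (2026, arXiv:2602.04022, §6.6) names two remaining analytic steps of his programme:
(M1) for every (large) window the bottom of the truncated Weil form is simple and even
(`WeilWindowSimpleEven a`), whence by Connes–van Suijlekom (CMP 2025, Thm. 6.1; the named fact
`Connes2026_weilGroundState_zeros_re_eq_half`) the Mellin transform of the ground state has all its
zeros on the critical line; (M2) the ground states approximate the prolate vectors `k_λ` well enough
that their (normalised) Mellin transforms converge to Riemann's `Ξ`.

This file lands the ASSEMBLY of that endgame as kernel theorems, making precise what (M2) has to
deliver: locally uniform convergence on the open strip `|Im z| < 1/2` (the image of the critical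
strip under `s = 1/2 + i z`) of real-zero entire approximants to `Ξ` is exactly what Hurwitz's
/-- `needs,` (auxiliary; see the module docstring). -/
theorem needs, and nothing about the approximants off the strip or about rates is used.

* `riemannHypothesis_of_tendstoLocallyUniformlyOn` — Hurwitz assembly: if functions `F n`,
  holomorphic on the strip and (frequently) without non-real zeros in the strip, converge locally
  uniformly on the strip to `Ξ = riemannXiUpper`, then `RiemannHypothesis`.
* `riemannHypothesis_iff_exists_realZero_approximants` — the criterion loses nothing: RH is
  EQUIVALENT to the existence of such approximants (under RH, `F n = Ξ`).
* `riemannHypothesis_of_weilGroundStates` — the programme form: the fact (C–vS Thm. 6.1) +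
  (M1) along any non-trivial filter of windows + (M2) in the form "for some constants `c n ≠ 0`,
  `z ↦ c n · û_n(1/2 + i z)` converges locally uniformly on the strip to `Ξ`" imply RH.
* `riemannHypothesis_of_L2_tracking` — (M2) split into its classical half (Connes's Fact 6.4:
  the transforms of EXPLICIT comparison vectors `kₙ` converge to `Ξ` on the strip) and its hard
  half, typed: weighted `L²` tracking `e^{α aₙ} √(2aₙ) ‖cₙ uₙ − kₙ‖₂ → 0` for all `0 < α < 1/2`
  (via the Cauchy–Schwarz strip bound `norm_weilMellin_le_of_ae_vanish`).
* `groundState_dist_sq_le` — the Temple–Kato inequality `(ε₁ − ε₀)‖k − ⟪θ,k⟫θ‖² ≤ q k − ε₀‖k‖²`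
  for a simple gapped ground state of an abstract quadratic form: tracking is governed by the
  EXCESS ENERGY of `kₙ` relative to the GAP, two relative quantities of size `~ e^{-4πλ²}`.
-/

noncomputable section

noncomputable section

open Complex Filter Set Topology Metric MeasureTheory
open Literature.NumberTheory.LFunctions

namespace Summit.RiemannHypothesis.RiemannHypothesis.Theorems

/-- The open horizontal strip `|Im z| < 1/2`, image of the open critical strip `0 < Re s < 1`
under `s = 1/2 + i z`. -/
def xiStrip : Set ℂ := {z : ℂ | |z.im| < 1 / 2}

/-- The upper half `0 < Im z < 1/2` of the strip, written as an intersection of half planes. -/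
def xiStripUpper : Set ℂ := {z : ℂ | 0 < z.im} ∩ {z : ℂ | z.im < 1 / 2}

/-- The lower half `-1/2 < Im z < 0` of the strip. -/
def xiStripLower : Set ℂ := {z : ℂ | -(1 / 2) < z.im} ∩ {z : ℂ | z.im < 0}

/-- `isOpen_xiStripUpper` (auxiliary; see the module docstring). -/
theorem isOpen_xiStripUpper : IsOpen xiStripUpper :=
  (isOpen_lt continuous_const Complex.continuous_im).inter
    (isOpen_lt Complex.continuous_im continuous_const)

/-- `isOpen_xiStripLower` (auxiliary; see the module docstring). -/
theorem isOpen_xiStripLower : IsOpen xiStripLower :=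
  (isOpen_lt continuous_const Complex.continuous_im).inter
    (isOpen_lt Complex.continuous_im continuous_const)

/-- `isPreconnected_xiStripUpper` (auxiliary; see the module docstring). -/
theorem isPreconnected_xiStripUpper : IsPreconnected xiStripUpper :=
  ((convex_halfSpace_im_gt (0 : ℝ)).inter (convex_halfSpace_im_lt (1 / 2 : ℝ))).isPreconnected

/-- `isPreconnected_xiStripLower` (auxiliary; see the module docstring). -/
theorem isPreconnected_xiStripLower : IsPreconnected xiStripLower :=
  ((convex_halfSpace_im_gt (-(1 / 2) : ℝ)).inter (convex_halfSpace_im_lt (0 : ℝ))).isPreconnected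

/-- `xiStripUpper_subset` (auxiliary; see the module docstring). -/
theorem xiStripUpper_subset : xiStripUpper ⊆ xiStrip := by
  rintro z ⟨h1, h2⟩
  simp only [xiStrip, mem_setOf_eq] at h1 h2 ⊢
  rw [abs_lt]; constructor <;> linarith

/-- `xiStripLower_subset` (auxiliary; see the module docstring). -/
theorem xiStripLower_subset : xiStripLower ⊆ xiStrip := by
  rintro z ⟨h1, h2⟩
  simp only [xiStrip, mem_setOf_eq] at h1 h2 ⊢
  rw [abs_lt]; constructor <;> linarith

/-- `Ξ` is entire. -/
theorem differentiable_riemannXiUpper' : Differentiable ℂ riemannXiUpper := by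
  have h : riemannXiUpper = fun z ↦ riemannXi (1 / 2 + I * z) := rfl
  rw [h]
  exact differentiable_riemannXi.comp
    ((differentiable_const _).add ((differentiable_const _).mul differentiable_id))

/-- `Ξ(i/2) = ξ(0) = 1/2`; in particular `Ξ` is not identically zero. -/
theorem riemannXiUpper_I_div_two : riemannXiUpper (I / 2) = 1 / 2 := by
  have h : (1 / 2 : ℂ) + I * (I / 2) = 0 := by
    rw [show I * (I / 2) = I * I / 2 by ring, I_mul_I]; ring
  rw [riemannXiUpper, h, riemannXi_zero]

/-- A zero of `Ξ` lies in the strip `|Im z| < 1/2` (the zeros of `ξ` are the nontrivial zeros of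
`ζ`, which have `0 < Re s < 1`). -/
theorem mem_xiStrip_of_riemannXiUpper_eq_zero {z : ℂ} (hz : riemannXiUpper z = 0) : z ∈ xiStrip := by
  obtain ⟨-, h0, h1⟩ := (riemannXi_eq_zero_iff_holds (1 / 2 + I * z)).1 hz
  simp only [add_re, mul_re, I_re, I_im, zero_mul, one_mul, zero_sub] at h0 h1
  norm_num at h0 h1
  simp only [xiStrip, mem_setOf_eq, abs_lt]
  constructor <;> linarith

/-- `Ξ` does not vanish identically on any nonempty open set. -/
theorem not_eqOn_zero_riemannXiUpper {U : Set ℂ} (hU : IsOpen U) {z : ℂ} (hz : z ∈ U)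
    (h : EqOn riemannXiUpper 0 U) : False := by
  have han : AnalyticOnNhd ℂ riemannXiUpper univ :=
    differentiable_riemannXiUpper'.differentiableOn.analyticOnNhd isOpen_univ
  have hev : riemannXiUpper =ᶠ[𝓝 z] 0 := Filter.eventuallyEq_of_mem (hU.mem_nhds hz) h
  have hall := han.eqOn_zero_of_preconnected_of_eventuallyEq_zero isPreconnected_univ (mem_univ z) hev
  have := hall (mem_univ (I / 2))
  rw [riemannXiUpper_I_div_two] at this
  norm_num at this

/-- **Hurwitz assembly.** Let `F n → Ξ` locally uniformly on the open strip `|Im z| < 1/2` along a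
non-trivial filter, with `F n` holomorphic on the strip eventually and, frequently, having no
non-real zero in the strip. Then the Riemann hypothesis holds. (Hurwitz's theorem on each half
strip `0 < ± Im z < 1/2`, which contains no real point; `Ξ ≢ 0`.) -/
theorem riemannHypothesis_of_tendstoLocallyUniformlyOn {ι : Type*} {l : Filter ι} [l.NeBot]
    (F : ι → ℂ → ℂ) (hF : ∀ᶠ n in l, DifferentiableOn ℂ (F n) xiStrip)
    (hreal : ∃ᶠ n in l, ∀ z ∈ xiStrip, F n z = 0 → z.im = 0)
    (hlim : TendstoLocallyUniformlyOn F riemannXiUpper l xiStrip) : _root_.RiemannHypothesis := by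
  refine riemannHypothesis_iff_im_eq_zero_of_riemannXiUpper_eq_zero_holds.2 fun z hz ↦ ?_
  have hzS := mem_xiStrip_of_riemannXiUpper_eq_zero hz
  by_contra him
  rcases lt_or_gt_of_ne him with hneg | hpos
  · -- lower half strip
    have hzU : z ∈ xiStripLower := by
      refine ⟨?_, hneg⟩
      simp only [xiStrip, mem_setOf_eq, abs_lt] at hzS
      exact hzS.1
    have h0 : ∃ᶠ n in l, ∀ w ∈ xiStripLower, F n w ≠ 0 := by
      refine hreal.mono fun n hn w hw hw0 ↦ ?_
      have := hn w (xiStripLower_subset hw) hw0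
      exact (lt_irrefl (0 : ℝ)) (this ▸ hw.2)
    rcases Complex.hurwitz_eqOn_zero_or_forall_ne_zero isOpen_xiStripLower isPreconnected_xiStripLower
        (hF.mono fun n hn ↦ hn.mono xiStripLower_subset) (hlim.mono xiStripLower_subset) h0 with h | h
    · exact not_eqOn_zero_riemannXiUpper isOpen_xiStripLower hzU h
    · exact h z hzU hz
  · -- upper half strip
    have hzU : z ∈ xiStripUpper := by
      refine ⟨hpos, ?_⟩
      simp only [xiStrip, mem_setOf_eq, abs_lt] at hzS
      exact hzS.2
    have h0 : ∃ᶠ n in l, ∀ w ∈ xiStripUpper, F n w ≠ 0 := by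
      refine hreal.mono fun n hn w hw hw0 ↦ ?_
      have := hn w (xiStripUpper_subset hw) hw0
      exact (lt_irrefl (0 : ℝ)) (this ▸ hw.1)
    rcases Complex.hurwitz_eqOn_zero_or_forall_ne_zero isOpen_xiStripUpper isPreconnected_xiStripUpper
        (hF.mono fun n hn ↦ hn.mono xiStripUpper_subset) (hlim.mono xiStripUpper_subset) h0 with h | h
    · exact not_eqOn_zero_riemannXiUpper isOpen_xiStripUpper hzU h
    · exact h z hzU hz

/-- Sequential, entire-functions form of the Hurwitz assembly: entire `F n` with only real zeros
converging to `Ξ` locally uniformly on the strip give RH. -/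
theorem riemannHypothesis_of_realZero_approximants (F : ℕ → ℂ → ℂ)
    (hF : ∀ n, Differentiable ℂ (F n)) (hreal : ∀ n z, F n z = 0 → z.im = 0)
    (hlim : TendstoLocallyUniformlyOn F riemannXiUpper atTop xiStrip) : _root_.RiemannHypothesis :=
  riemannHypothesis_of_tendstoLocallyUniformlyOn F
    (Eventually.of_forall fun n ↦ (hF n).differentiableOn)
    (Frequently.of_forall fun n z _ hz ↦ hreal n z hz) hlim

/-- The criterion loses nothing: RH holds iff `Ξ` is, on the strip `|Im z| < 1/2`, a locally
uniform limit of entire functions having only real zeros (under RH take `F n = Ξ`). -/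
theorem riemannHypothesis_iff_exists_realZero_approximants :
    _root_.RiemannHypothesis ↔ ∃ F : ℕ → ℂ → ℂ, (∀ n, Differentiable ℂ (F n)) ∧
      (∀ n z, F n z = 0 → z.im = 0) ∧ TendstoLocallyUniformlyOn F riemannXiUpper atTop xiStrip := by
  constructor
  · intro hRH
    refine ⟨fun _ ↦ riemannXiUpper, fun _ ↦ differentiable_riemannXiUpper', fun _ z hz ↦
      riemannHypothesis_iff_im_eq_zero_of_riemannXiUpper_eq_zero_holds.1 hRH z hz, ?_⟩
    have hU : TendstoUniformlyOn (fun _ : ℕ ↦ riemannXiUpper) riemannXiUpper atTop xiStrip :=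
      Metric.tendstoUniformlyOn_iff.2 fun ε hε ↦ Eventually.of_forall fun n x _ ↦ by simpa using hε
    exact hU.tendstoLocallyUniformlyOn
  · rintro ⟨F, hF, hreal, hlim⟩
    exact riemannHypothesis_of_realZero_approximants F hF hreal hlim

/-- **The programme form (Connes 2026, §6.6, assembled).** Assume the named fact
`Connes2026_weilGroundState_zeros_re_eq_half` (Connes–van Suijlekom 2025, Thm. 6.1). Let `a n` be
windows, `u n` ground states of the truncated Weil form on `[-a n, a n]`, along a non-trivial filter
`l`, such that (M1) eventually the bottom of the form on the window is simple and even, and (M2) for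
some constants `c n ≠ 0` the normalised transforms `z ↦ c n · û_n(1/2 + i z)` converge to `Ξ`
locally uniformly on the strip `|Im z| < 1/2`. Then the Riemann hypothesis holds. -/
theorem riemannHypothesis_of_weilGroundStates
    (hfact : Connes2026_weilGroundState_zeros_re_eq_half)
    {ι : Type*} {l : Filter ι} [l.NeBot] (a : ι → ℝ) (u : ι → ℝ → ℂ) (c : ι → ℂ)
    (hM1 : ∀ᶠ n in l, WeilWindowSimpleEven (a n))
    (hu : ∀ᶠ n in l, IsWeilGroundState (a n) (u n))
    (hc : ∀ᶠ n in l, c n ≠ 0)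
    (hM2 : TendstoLocallyUniformlyOn (fun n z ↦ c n * weilMellin (u n) (1 / 2 + I * z))
      riemannXiUpper l xiStrip) :
    _root_.RiemannHypothesis := by
  refine riemannHypothesis_of_tendstoLocallyUniformlyOn _ ?_ ?_ hM2
  · filter_upwards [hu] with n hn
    exact ((differentiable_const _).mul (hn.differentiable_weilMellin.comp
      ((differentiable_const _).add ((differentiable_const _).mul differentiable_id)))).differentiableOn
  · refine (hM1.and (hu.and hc)).frequently.mono ?_
    rintro n ⟨h1, h2, h3⟩ z _ hz
    rcases mul_eq_zero.1 hz with h | h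
    · exact absurd h h3
    · exact Connes2026_weilGroundState_zeros_re_eq_half.im_eq_zero_of_fourier_eq_zero hfact h1 h2 h

/-- The summit by name: the fact (C–vS Thm. 6.1) + (M1) + (M2) along a sequence of windows give
`Summit.RiemannHypothesis`. -/
theorem summit_of_weilGroundStates
    (hfact : Connes2026_weilGroundState_zeros_re_eq_half)
    (a : ℕ → ℝ) (u : ℕ → ℝ → ℂ) (c : ℕ → ℂ)
    (hM1 : ∀ n, WeilWindowSimpleEven (a n)) (hu : ∀ n, IsWeilGroundState (a n) (u n))
    (hc : ∀ n, c n ≠ 0)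
    (hM2 : TendstoLocallyUniformlyOn (fun n z ↦ c n * weilMellin (u n) (1 / 2 + I * z))
      riemannXiUpper atTop xiStrip) :
    Summit.RiemannHypothesis :=
  riemannHypothesis_of_weilGroundStates hfact a u c (Eventually.of_forall hM1)
    (Eventually.of_forall hu) (Eventually.of_forall hc) hM2

end Summit.RiemannHypothesis.RiemannHypothesis.Theorems
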